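import Mathlib
import Summits.QuantumFields.BalabanUV.Beta.CovariantPlateauBlocksPair
import Summits.QuantumFields.BalabanUV.Beta.CovariantPlateauBlocksGauge

/-!
# Beta / CovariantPlateauBlocksPairGauge — THE GENERAL-U MODEL INSTANCE OF E-I3, PART 6: the two-transport END from the
# (3.35)-LITERAL GAUGE HYPOTHESIS ALONE (the row-D4 owner's «cheaper route» NOTE-I3 v1.2.2 §6.6, journal l.16170): in a per-block
# gauge making every in-block bond transporter ε-close to `1`, BOTH contour transports are products of gauged bond variables and
# the mixed loop is gauge-covariant, so its defect is LINEAR — `≤ (|tree word| + |ω word|)·ε = 2|v|₁·ε ≤ 2ν(n−1)·ε` — with NO area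
# law; together with part 3's `h ≤ (2ν(n−1)+1)·ε` this wires d4-p3's `coarse_coercive_cov₂` from ONE gauge hypothesis
# (unit `b2b-balaban-beta-d4-p2`, GEN 6, MODEL crew; sequel of claim «E-I3-COV-PAIR» journal l.16069∕l.16271; v1.0.1 GEN 7:
# docstring-only precision of the END's j-uniformity sentence after d4-p3-g7 XREAD C-d4p3-20, no declaration changed)

HONEST FRAMING: discharging `BetaPertH` makes Bałaban's UV stability UNCONDITIONAL — NOT the continuum limit, NOT the
Clay problem.  HONEST DEPENDENCY (verbatim): «continuum YM on T⁴ ⇐ BetaPertH ∧ nine spine estimates (0/9 proved);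
BetaPertH ⇐ (D1) ∧ (D4) ∧ CAP+tail; G-an2-4 gates asym, D1 and NE2/3/4.»  THIS MODULE DISCHARGES NOTHING of `BetaPertH`,
asserts NOTHING printed and cites nothing as a fact (ABSOLUTE RULE): [folklore] about a MODEL (b07's ℤ^d words∕transports∕gauges;
cubic blocks, any gluing, orthogonal transporters and block gauges as DATA; one fine field along fine contours — Bałaban's averaged
legs `Ū^l` of (3.55) NOT modelled); nothing of his operators instantiated.  SHAPES located at [B9] = `Balaban1985BackgroundPropagators`
(3.35) p. 396 («there exists a gauge transformation u on □ such that Uᵘ = e^{iηA}, … |A| < O(1)Mα₀(L^jη)^{−1}» — the |A|-half), (3.55) p. 401.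
No class change on row D4 or G-B9-15 (width 0; D4 DISCHARGE NO DATE); NOT BetaPertH, NOT continuum, NOT Clay, NOT summit progress.

CONTENT (kernel, 0 sorry).  §1 (ℤ^d, U1 units) **`norm_hol_posWord_mul_inv_le_of_gauge`**: two positive words with the same
displacement, starting and ending in a box on whose bonds some U1 gauge makes the configuration ε-close to `1`:
`‖V(w₁)V(w₂)⁻¹ − 1‖ ≤ (|w₁| + |w₂|)·ε` (gauge covariance of the loop + product bound on b07's `clampCfg` of the gauged field).
§2 the instance: **`norm_mixed_loop_le_of_gauge`** (`‖cpx(Rtr x·(Rgen ω x)ᵀ) − 1‖ ≤ 2ν(n−1)·ε`), `mixed_defect_le_of_gauge`, END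
**`coarse_coercive_plateau_blocks_pair_gauge`** (d4-p3's `coarse_coercive_cov₂` BY NAME; `ε_mix = 2ν(n−1)ε`, `H = (2ν(n−1)+1)ε`).
§3 non-vacuity.
-/

namespace Summit.QuantumFields.BalabanUV.Beta.CovariantPlateauBlocksPairGauge

open scoped BigOperators Matrix Matrix.Norms.L2Operator
open Finset
open Literature.MathematicalPhysics.QuantumFieldTheory.Balaban1983to89.B5Prop11Lower (nsq nsq_nonneg)
open Literature.MathematicalPhysics.QuantumFieldTheory.Balaban1983to89.B7Prop1Explicit
open Literature.MathematicalPhysics.QuantumFieldTheory.Balaban1983to89.B7Prop1Local (InBox AgreeOn clampCfg clampCfg_agree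
  clampCfg_mem)
open Literature.MathematicalPhysics.QuantumFieldTheory.Balaban1983to89 (B8Ineq170.norm_mul_sub_one_le_of_norm_le_one)
open Summit.QuantumFields.BalabanUV.Beta.AccretiveCombesThomasSandwich (sandwich)
open Summit.QuantumFields.BalabanUV.Beta.CoarseCoerciveTransport (covFamily)
open Summit.QuantumFields.BalabanUV.Beta.CoarseCoerciveCovariantEnergy (covDiff)
open Summit.QuantumFields.BalabanUV.Beta.CoarseCoerciveTransportPair (coarse_coercive_cov₂)
open Summit.QuantumFields.BalabanUV.Beta.CoarseCoerciveBlock1D (gramForm gramForm_isHermitian isUnit_gramForm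
  re_form_gramForm re_form_gramForm_nonneg)
open Summit.QuantumFields.BalabanUV.Beta.ThinLoopHolonomy
open Summit.QuantumFields.BalabanUV.Beta.MonotoneLoopHolonomy
open Summit.QuantumFields.BalabanUV.Beta.CovariantPlateauBlocks
open Summit.QuantumFields.BalabanUV.Beta.CovariantPlateauBlocksEnd
open Summit.QuantumFields.BalabanUV.Beta.CovariantPlateauBlocksGauge
open Summit.QuantumFields.BalabanUV.Beta.CovariantPlateauBlocksPair

noncomputable section

/-! ## §1 Two monotone contours with the same endpoints, in a small gauge: a LINEAR bound, no area law -/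

section Words

variable {d : ℕ} {𝔸 : Type*} [NormedRing 𝔸] [NormOneClass 𝔸]

/-- **TWO CONTOURS IN A SMALL GAUGE**: if a norm-≤-1 gauge `u` makes every bond variable of `Vᵘ` on the box `[lo, hi]` ε-close to `1`
(`ε ≥ 0`), then for two positive words with the same displacement, starting at `x ∈ [lo, hi]` and ending in the box,
`‖V(w₁)·V(w₂)⁻¹ − 1‖ ≤ (|w₁| + |w₂|)·ε` — the loop is conjugated by `u(x)` under the gauge, and in the gauge each transport is a
product of `|w_i|` bond variables of the box. [cite: Balaban1985BackgroundPropagators, (3.35) p.396] -/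
theorem norm_hol_posWord_mul_inv_le_of_gauge {lo hi : Site d} (hlohi : ∀ i, lo i ≤ hi i) (V : Site d → Fin d → 𝔸ˣ)
    (hV : ∀ x κ, V x κ ∈ U1 𝔸) {u : Site d → 𝔸ˣ} (hu : ∀ x, u x ∈ U1 𝔸) {ε : ℝ} (hε : 0 ≤ ε)
    (h335 : ∀ x κ, InBox lo hi x → InBox lo hi (x + e κ) → ‖((gaugeAct u V x κ : 𝔸ˣ) : 𝔸) - 1‖ ≤ ε)
    {x : Site d} (hx : InBox lo hi x) {w₁ w₂ : List (Fin d)} (hdisp : disp (posWord w₁) = disp (posWord w₂))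
    (hend : InBox lo hi (x + disp (posWord w₁))) :
    ‖((hol V x (posWord w₁) * (hol V x (posWord w₂))⁻¹ : 𝔸ˣ) : 𝔸) - 1‖ ≤ (w₁.length + w₂.length) * ε := by
  set V' := gaugeAct u V with hV'
  set W := clampCfg lo hi V' with hW
  have hV'm : ∀ x κ, V' x κ ∈ U1 𝔸 := gaugeAct_mem hV hu
  have hWm : ∀ x κ, W x κ ∈ U1 𝔸 := clampCfg_mem hV'm
  have hWε : ∀ x κ, ‖((W x κ : 𝔸ˣ) : 𝔸) - 1‖ ≤ ε := norm_clampCfg_sub_one_le hlohi _ hε h335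
  -- the loop under the gauge is conjugated by `u x`
  have hconj : hol V' x (posWord w₁) * (hol V' x (posWord w₂))⁻¹ =
      u x * (hol V x (posWord w₁) * (hol V x (posWord w₂))⁻¹) * (u x)⁻¹ := by
    rw [hV', hol_gaugeAct, hol_gaugeAct, ← hdisp]
    group
  have hback : hol V x (posWord w₁) * (hol V x (posWord w₂))⁻¹ =
      (u x)⁻¹ * (hol V' x (posWord w₁) * (hol V' x (posWord w₂))⁻¹) * u x := by
    rw [hconj]; group
  -- in the gauge, replace by the clamped field (locality of monotone words inside the box)
  have hag : AgreeOn lo hi W V' := clampCfg_agree V'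
  have h1 : hol V' x (posWord w₁) = hol W x (posWord w₁) := (hol_posWord_congr hag w₁ x hx hend).symm
  have h2 : hol V' x (posWord w₂) = hol W x (posWord w₂) := (hol_posWord_congr hag w₂ x hx (by rwa [← hdisp])).symm
  rw [hback, Units.val_mul, Units.val_mul]
  refine (norm_units_inv_conj_sub_one_le (hu x) _).trans ?_
  rw [h1, h2, Units.val_mul]
  have hA : ‖((hol W x (posWord w₁) : 𝔸ˣ) : 𝔸)‖ ≤ 1 := (hol_mem hWm _ _).1
  calc _ ≤ ‖((hol W x (posWord w₁) : 𝔸ˣ) : 𝔸) - 1‖ + ‖(((hol W x (posWord w₂))⁻¹ : 𝔸ˣ) : 𝔸) - 1‖ :=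
        B8Ineq170.norm_mul_sub_one_le_of_norm_le_one hA
    _ ≤ (posWord w₁).length * ε + (posWord w₂).length * ε :=
        add_le_add (norm_hol_sub_one_le_length_mul hWm hWε _ _)
          ((norm_inv_sub_one_le (hol_mem hWm _ _)).trans (norm_hol_sub_one_le_length_mul hWm hWε _ _))
    _ = (w₁.length + w₂.length) * ε := by rw [length_posWord, length_posWord]; ring

end Words

/-! ## §2 The instance: mixed-loop defect and the two-transport END from the gauge hypothesis alone -/

section Instance

variable {Y : Type*} [Fintype Y] [DecidableEq Y] {Cp : Type*} [Fintype Cp] [DecidableEq Cp] {ν n w : ℕ} [NeZero n]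
variable (W : Bond Y ν n → Matrix Cp Cp ℝ) (hW : ∀ b, (W b)ᵀ * W b = 1) (ω : Off ν n → List (Fin ν))

omit [Fintype Y] [DecidableEq Y] in
/-- **THE MIXED-LOOP DEFECT FROM THE GAUGE HYPOTHESIS**: with a per-block orthogonal gauge `g_y` making every in-block bond transporter
ε-close to `1` (`‖cpx(g_y(v)W((y,v),κ)g_y(v+e_κ)ᵀ) − 1‖ ≤ ε`), for ANY monotone contour family `ω` with `disp = emb v`:
`‖cpx(Rtr x·(Rgen ω x)ᵀ) − 1‖ ≤ 2ν(n−1)·ε` — linear in the contour length, no area law. [cite: Balaban1985BackgroundPropagators, (3.35) p.396] -/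
theorem norm_mixed_loop_le_of_gauge [Nonempty Cp] (g : Y → Off ν n → Matrix Cp Cp ℝ) (hg : ∀ y v, (g y v)ᵀ * g y v = 1)
    (hω : ∀ v, disp (posWord (ω v)) = emb v) {ε : ℝ} (hε : 0 ≤ ε)
    (h335 : ∀ (y : Y) (v : Off ν n) (κ : Fin ν) (h : (v κ : ℕ) + 1 < n),
      ‖cpxHom (g y v * W ((y, v), κ) * (g y (succOff v κ h))ᵀ) - 1‖ ≤ ε) (x : BSite Y ν n) :
    ‖cpxHom (Rtr W hW x * (Rgen W hW ω x)ᵀ) - 1‖ ≤ 2 * (ν * ((n : ℝ) - 1)) * ε := by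
  have hn1 : ∀ i, (0 : Site ν) i ≤ boxHi ν n i := fun i => by
    have := Nat.pos_of_ne_zero (NeZero.ne n)
    simp only [boxHi, Pi.zero_apply]; omega
  have hz : ∀ i, 0 ≤ emb x.2 i := fun i => (emb_inBox x.2 i).1
  have hdisp : disp (posWord (treeList (emb x.2))) = disp (posWord (ω x.2)) := by rw [disp_posWord_treeList _ hz, hω]
  have hlen1 : (treeList (emb x.2)).length = l1 (emb x.2) := length_treeList _ hz
  have hlen2 : (ω x.2).length = l1 (emb x.2) := by rw [← (perm_of_disp_eq hdisp).length_eq, hlen1]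
  have hG := norm_hol_posWord_mul_inv_le_of_gauge hn1 (cpxCfg W hW x.1) (cpxCfg_mem W hW x.1) (gaugeCfg_mem g hg x.1) hε
    (fun z κ hz' hze => by
      obtain ⟨v, h, rfl, _⟩ := exists_off_of_bondIn hz' hze
      rw [val_gaugeAct_gaugeCfg W hW g hg x.1 v κ h]
      exact h335 x.1 v κ h)
    (x := 0) (fun i => ⟨le_rfl, hn1 i⟩) hdisp (by rw [disp_posWord_treeList _ hz, zero_add]; exact emb_inBox _)
  rw [cpxHom_mixed_eq]
  refine hG.trans ?_
  rw [hlen1, hlen2]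
  have h1 := l1_emb_le x.2
  nlinarith

omit [Fintype Y] [DecidableEq Y] in
/-- … in d4-p3's `hdef` currency. [folklore] -/
theorem mixed_defect_le_of_gauge [Nonempty Cp] (g : Y → Off ν n → Matrix Cp Cp ℝ) (hg : ∀ y v, (g y v)ᵀ * g y v = 1)
    (hω : ∀ v, disp (posWord (ω v)) = emb v) {ε : ℝ} (hε : 0 ≤ ε)
    (h335 : ∀ (y : Y) (v : Off ν n) (κ : Fin ν) (h : (v κ : ℕ) + 1 < n),
      ‖cpxHom (g y v * W ((y, v), κ) * (g y (succOff v κ h))ᵀ) - 1‖ ≤ ε) (y : Y) (x : BSite Y ν n) (v : Cp → ℂ) :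
    CoarseCoerciveCovariantEnergy.l2
        ((CoarseCoerciveCovariantEnergy.cpx (Rfam W hW y x * (RgenFam W hW ω y x)ᵀ) - 1) *ᵥ v) ≤
      2 * (ν * ((n : ℝ) - 1)) * ε * CoarseCoerciveCovariantEnergy.l2 v := by
  have hc : CoarseCoerciveCovariantEnergy.cpx (Rfam W hW y x * (RgenFam W hW ω y x)ᵀ) - 1 =
      cpxHom (Rtr W hW x * (Rgen W hW ω x)ᵀ) - 1 := by
    rw [CoarseCoerciveCovariantEnergy.cpx]; rfl
  rw [hc]
  exact (norm_toLp_mulVec_le _ v).trans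
    (mul_le_mul_of_nonneg_right (norm_mixed_loop_le_of_gauge W hW ω g hg hω hε h335 x) (norm_nonneg _))

/-- **E-I3 WITH TWO TRANSPORTS FROM THE (3.35)-LITERAL GAUGE HYPOTHESIS ALONE (MODEL).**  Per-block orthogonal gauges making the
in-block bond transporters ε-close to `1`; average on ANY monotone contour family `ω`, bumps on the tree transports; with
`H = (2ν(n−1)+1)·ε` (thin loops, part 3) and `ε_mix = 2ν(n−1)·ε < 1` (mixed loops, §1):
`((1 − ε_mix)((n−2w)/n)^ν)² / (μ₀n^ν + (1/w + H)(ν n^ν (1/w + H))) · ‖B‖² ≤ Re B*(Q̃_ω A_W⁻¹ Q̃_ωᵀ)B` — d4-p3's `coarse_coercive_cov₂`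
BY NAME.  j-UNIFORMITY (v1.0.1, d4-p3-g7 XREAD C-d4p3-20 DOCFIX-LOW-1 adopted): with `n·ε = O(Mα₀)` (the |A|-half of (3.35)) the
mass factor `1 − ε_mix` and `ε_mix` ARE j-uniform, but the thin-loop constant `H = (2ν(n−1)+1)·ε = O(Mα₀)` is NOT of the slope's
order `1/w` (`H·w ≍ Mα₀·n/2`), so this END is `(1 + O(Mα₀))`-comparable with the `U = 1` constant only when a fine-scale mass
`μ₀ ≳ 1` dominates `E`; in the block-mass regime `μ₀ ≲ w⁻²` the j-uniform comparison is carried by the plaquette route (part 5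
`coarse_coercive_plateau_blocks_pair` with per-plaquette `α = O(Mα₀/n²)`, both halves of (3.35)), not by this END.
[cite: Balaban1985BackgroundPropagators, (3.35) p.396, (3.55) p.401] -/
theorem coarse_coercive_plateau_blocks_pair_gauge [Nonempty Cp] (σ : Fin ν → Y → Y) (g : Y → Off ν n → Matrix Cp Cp ℝ)
    (hg : ∀ y v, (g y v)ᵀ * g y v = 1) (hω : ∀ v, disp (posWord (ω v)) = emb v) (hw : 0 < w) (h2w : 2 * w < n)
    {μ0 : ℝ} (hμ0 : 0 < μ0) {ε : ℝ} (hε : 0 ≤ ε) (hεmix : 2 * (ν * ((n : ℝ) - 1)) * ε < 1)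
    (h335 : ∀ (y : Y) (v : Off ν n) (κ : Fin ν) (h : (v κ : ℕ) + 1 < n),
      ‖cpxHom (g y v * W ((y, v), κ) * (g y (succOff v κ h))ᵀ) - 1‖ ≤ ε) (B : Y × Cp → ℂ) :
    ((1 - 2 * (ν * ((n : ℝ) - 1)) * ε) * (((n : ℝ) - 2 * w) / n) ^ ν) ^ 2 /
        (μ0 * (1 * (n : ℝ) ^ ν) + (1 / w + (2 * (ν * ((n : ℝ) - 1)) + 1) * ε) *
          (ν * (n : ℝ) ^ ν * (1 / w + (2 * (ν * ((n : ℝ) - 1)) + 1) * ε))) * nsq B ≤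
      (star B ⬝ᵥ (sandwich (gramForm μ0 (covDiff bsrc (btgt σ) W)) (covFamily sB (RgenFam W hW ω)) *ᵥ B)).re := by
  have hn : (0 : ℝ) < n := by exact_mod_cast Nat.pos_of_ne_zero (NeZero.ne n)
  have hn1 : 0 ≤ (n : ℝ) - 1 := by
    have : (1 : ℝ) ≤ n := by exact_mod_cast Nat.pos_of_ne_zero (NeZero.ne n)
    linarith
  have hH0 : 0 ≤ (2 * (ν * ((n : ℝ) - 1)) + 1) * ε := by positivity
  have hH := fun (b : Bond Y ν n) (hb : (b.1.2 b.2 : ℕ) + 1 < n) (y : Y) => hdef_le_of_gauge W hW g hg σ hε h335 hb y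
  have hδ0 : 0 < (((n : ℝ) - 2 * w) / n) ^ ν := by
    have : (0 : ℝ) < (n : ℝ) - 2 * w := by
      have : (2 * w : ℝ) < n := by exact_mod_cast h2w
      linarith
    positivity
  have hθ0 : (0 : ℝ) ≤ 1 / w + (2 * (ν * ((n : ℝ) - 1)) + 1) * ε := by positivity
  have hE : 0 < μ0 * (1 * (n : ℝ) ^ ν) + (1 / w + (2 * (ν * ((n : ℝ) - 1)) + 1) * ε) *
      (ν * (n : ℝ) ^ ν * (1 / w + (2 * (ν * ((n : ℝ) - 1)) + 1) * ε)) := by positivity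
  exact coarse_coercive_cov₂ (gramForm μ0 (covDiff bsrc (btgt σ) W)) (gramForm_isHermitian _ _) (isUnit_gramForm hμ0 _)
    (re_form_gramForm_nonneg hμ0.le _) bsrc (btgt σ) W hμ0.le (fun z => (re_form_gramForm μ0 _ z).le) (tB w) sB
    (fun y y' x h => tB_mul_sB_eq_zero y y' x h) (tB_mul_sB_nonneg hw) (RgenFam W hW ω) (Rfam W hW)
    (fun _ x => Rtr_mul_transpose W hW x) hW hδ0 (mass_ge hw h2w.le) hεmix (mixed_defect_le_of_gauge W hW ω g hg hω hε h335)
    (hdef W hW σ) (hdef_nonneg W hW σ) (hhol_hdef W hW σ) zero_le_one (sum_abs_tB_site_le hw) (sum_abs_tB_block_le hw)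
    hθ0 (row_le W hW σ hw hH0 hH) (col_le W hW σ hw hH0 hH) hE B

end Instance

/-! ## §3 Non-vacuity -/

/-- One block of side 3, `ν = 1`, `w = 1`, fibre `Unit`, flat `W`, trivial gauge, `μ₀ = 1`, `ε = 0`, the (3.55)-shape contour
`nestedList 2 1`: the gauge-route END gives the explicit constant `1/54`. [folklore] -/
example (B : Unit × Unit → ℂ) :
    (1 / 54 : ℝ) * nsq B ≤
      (star B ⬝ᵥ (sandwich (gramForm 1 (covDiff bsrc (btgt (fun (_ : Fin 1) (_ : Unit) => ()))
          fun _ : Bond Unit 1 3 => (1 : Matrix Unit Unit ℝ)))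
        (covFamily (sB (Y := Unit) (ν := 1) (n := 3))
          (RgenFam (fun _ : Bond Unit 1 3 => (1 : Matrix Unit Unit ℝ)) flat_orth (nestedList 2 1))) *ᵥ B)).re := by
  have h := coarse_coercive_plateau_blocks_pair_gauge (Y := Unit) (Cp := Unit) (ν := 1) (n := 3) (w := 1) (μ0 := 1) (ε := 0)
    (fun _ : Bond Unit 1 3 => (1 : Matrix Unit Unit ℝ)) flat_orth (nestedList 2 1) (fun (_ : Fin 1) (_ : Unit) => ())
    (fun _ _ => (1 : Matrix Unit Unit ℝ)) (fun _ _ => by simp) (disp_posWord_nestedList 2 1) Nat.one_pos (by norm_num) one_pos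
    le_rfl (by norm_num) (fun y v κ h => by simp) B
  convert h using 2
  norm_num

end

end Summit.QuantumFields.BalabanUV.Beta.CovariantPlateauBlocksPairGauge
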